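import Summits.Ventures.YMGap.Thresholds.StarGaugeReceivedSum
import Mathlib.Analysis.SpecialFunctions.Pow.Real
import Mathlib.Analysis.SpecialFunctions.Sqrt
import HarnessLib

/-!
# Venture YMGap — track (c) «DS» in GENERAL DIMENSION `d`: the resolvent column of the gauge-fixed
# vertex star, its received sum `R_G^{(d)}(c) = (2d−2)c(1+c)/(1 − (2d−4)c − (2d−2)c²)`, and the door
# `R_G^{(d)}(c) < 1 ↔ (4d−4)c² + (4d−6)c < 1` (pure real arithmetic)

HONEST FRAMING: venture file (cell `pub-ymgap`, QuantumFields programme; seat ds-4, the DIMENSION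
column of the cell's `β₀(N, d)` table, STAR-DIMENSIONS.md), strong-coupling LATTICE bookkeeping only
(currency SC-a: exponential clustering of local observables uniformly in the volume).  This file is PURE
REAL ARITHMETIC, the general-`d` form of ds-2's `StarGaugeReceivedSum.lean` (`d = 4`).  The vertex star
of a site of `(ℤ/L)^d` has `2d` links; fixing the gauge at one star link `a` and perturbing the boundary
link of the star plaquette through `a` and its partner `b`, Föllmer's comparison on the `2d − 1`
remaining links with per-incidence coefficient `c` (`SU(2)`: `c = β_W/4`) produces the resolvent column
`D^{(a)} = (I − c·Adj_{2d−1})⁻¹ e_b` (`Adj` = «directions differ»), which by the symmetry fixing `a, b`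
has four values — at `b`, at the opposite link `b̄`, at `ā`, and at the `2d − 4` generic links:

  `D_b = 1 + D_b̄`, `D_b̄ = c²((2d−3) + (2d−2)c)/((1+2c)Δ)`, `D_ā = c/Δ`, `D_g = c(1+c)/((1+2c)Δ)`,
  `Δ = Δ_d(c) = 1 − (2d−4)c − (2d−2)c²`;

the position count (a given star link is seen in position `b` by `2d−2` ordered pairs, opposite to the
partner by `2d−2`, opposite to the frozen link by `2d−2`, generic by `(2d−2)(2d−4)`) gives the received
sum `R_G^{(d)}(c) = c((2d−2)(D_b + D_ā + D_b̄) + (2d−2)(2d−4)D_g) = (2d−2)c(1+c)/Δ_d(c)`.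

WHAT IS PROVED HERE (arithmetic only, every `d : ℕ`): the four values solve the symmetry-reduced
resolvent equations (`col_eq_abar/b/bbar/gen`) and are nonnegative below the pole (`col_nonneg`); the
count identity `gaugeR_eq_count`; the door `gaugeR d c < 1 ↔ (4d−4)c² + (4d−6)c < 1` below the pole and
the fact that the door polynomial condition itself forces `Δ_d(c) > 0` and `(2d−2)c < 1` (`d ≥ 2`), so it
is the ONLY smallness hypothesis the general-`d` Lemma G needs; the exact threshold
`c < c⋆(d) = (√(4d²−8d+5) − (2d−3))/(4(d−1))` (`β⋆_G(d) = 4c⋆(d)`: `d = 3`: `(√17−3)/2 = 0.5616`,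
`d = 4`: `(√37−5)/3 = 0.3609` = the tree row, `d = 5`: `(√65−7)/4 = 0.2656`, `d = 6`: `(√101−9)/5`);
consistency with the `d = 4` file (`gaugeR 4 c = StarWindowGauge.gaugeR (4c)`); and exact rational rows
`R_G^{(3)}(5/36) = 205/209`, `R_G^{(3)}(1/8) = 9/11`, `R_G^{(5)}(13/200) = 2769/2881`,
`R_G^{(5)}(1/16) = 17/19`, `R_G^{(6)}(1/20) = 21/23`, `R_G^{(2)}(1/4) = 5/7`.

WHAT THIS IS NOT.  It does NOT prove that `R_G^{(d)}` bounds anything: that is the general-`d` Lemma G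
(sibling files `StarColumnDim`, `StarLemmaGArrayDim`, `StarLemmaGSuperSolutionDim`,
`StarWindowBoundDim`), which feeds the tree's any-`d` torus door `DSWindow.star_abs_covariance_le`.
Nothing about confinement, the continuum or the Yang–Mills mass gap.

References (lineage of the bookkeeping): R. L. Dobrushin, S. B. Shlosman (1985) condition `C_V`;
H. Föllmer, LNM 1362 (1988) Ch. I (2.8), (2.17)–(2.21); cell files STAR-DIMENSIONS.md (ds-4),
GAUGE-STAR.md (ds-2).
-/

noncomputable section

namespace Summit.Ventures.YMGap.StarResolventDim

/-! ### The closed form in dimension `d` -/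

/-- `Δ_d(c) = 1 − (2d−4)c − (2d−2)c²`: the determinant factor of the symmetry-reduced resolvent of the
`(2d−1)`-link Dobrushin matrix `c·Adj` (gauge fixed at one star link). [folklore] -/
def Delta (d : ℕ) (c : ℝ) : ℝ := 1 - (2 * (d : ℝ) - 4) * c - (2 * (d : ℝ) - 2) * c ^ 2

/-- Resolvent column at the link opposite to the partner: `D_b̄ = c²((2d−3) + (2d−2)c)/((1+2c)Δ)`.
[folklore] -/
def Dbbar (d : ℕ) (c : ℝ) : ℝ :=
  c ^ 2 * ((2 * (d : ℝ) - 3) + (2 * (d : ℝ) - 2) * c) / ((1 + 2 * c) * Delta d c)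

/-- Resolvent column at the partner link itself: `D_b = 1 + D_b̄`. [folklore] -/
def Db (d : ℕ) (c : ℝ) : ℝ := 1 + Dbbar d c

/-- Resolvent column at the link opposite to the gauge-fixed one: `D_ā = c/Δ`. [folklore] -/
def Dabar (d : ℕ) (c : ℝ) : ℝ := c / Delta d c

/-- Resolvent column at each of the `2d − 4` generic links: `D_g = c(1+c)/((1+2c)Δ)`. [folklore] -/
def Dgen (d : ℕ) (c : ℝ) : ℝ := c * (1 + c) / ((1 + 2 * c) * Delta d c)

/-- **The gauge-fixed star received sum in dimension `d`**, as a function of the per-incidence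
coefficient `c`: `R_G^{(d)}(c) = (2d−2)c(1+c)/Δ_d(c)` (STAR-DIMENSIONS.md §1). [folklore] -/
def gaugeR (d : ℕ) (c : ℝ) : ℝ := (2 * (d : ℝ) - 2) * c * (1 + c) / Delta d c

/-- The door polynomial `P_d(c) = (4d−4)c² + (4d−6)c`; the door condition is `P_d(c) < 1` (equivalent
to `R_G^{(d)}(c) < 1` below the pole, and implying that one is below the pole). [folklore] -/
def doorPoly (d : ℕ) (c : ℝ) : ℝ := (4 * (d : ℝ) - 4) * c ^ 2 + (4 * (d : ℝ) - 6) * c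

/-! ### Positivity below the pole; the door condition is the only smallness hypothesis -/

/-- The door condition forces `Δ_d(c) > 0` (`d ≥ 2`, `c ≥ 0`):
`Δ_d(c) − (2d−2)c(1+c) = 1 − (4d−6)c − (4d−4)c² > 0`. [folklore] -/
theorem Delta_pos_of_door {d : ℕ} (hd : 2 ≤ d) {c : ℝ} (h0 : 0 ≤ c) (h : doorPoly d c < 1) :
    0 < Delta d c := by
  have hd' : (2 : ℝ) ≤ d := by exact_mod_cast hd
  unfold doorPoly at h
  unfold Delta
  nlinarith [mul_nonneg h0 h0, mul_nonneg (by linarith : (0 : ℝ) ≤ 2 * d - 2) h0,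
    mul_nonneg (by linarith : (0 : ℝ) ≤ 2 * d - 2) (mul_nonneg h0 h0)]

/-- The door condition forces the Föllmer row-sum bound `(2d−2)c < 1` (`d ≥ 2`, `c ≥ 0`). [folklore] -/
theorem coef_lt_one_of_door {d : ℕ} (hd : 2 ≤ d) {c : ℝ} (h0 : 0 ≤ c) (h : doorPoly d c < 1) :
    (2 * (d : ℝ) - 2) * c < 1 := by
  have hd' : (2 : ℝ) ≤ d := by exact_mod_cast hd
  unfold doorPoly at h
  nlinarith [mul_nonneg h0 h0, mul_nonneg (by linarith : (0 : ℝ) ≤ 4 * d - 4) (mul_nonneg h0 h0),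
    mul_nonneg (by linarith : (0 : ℝ) ≤ 2 * d - 4) h0]

/-- The door condition at `c ≥ 0` is inherited by every smaller `c' ∈ [0, c]`. [folklore] -/
theorem doorPoly_lt_one_mono {d : ℕ} (hd : 2 ≤ d) {c c' : ℝ} (h0 : 0 ≤ c') (hle : c' ≤ c)
    (h : doorPoly d c < 1) : doorPoly d c' < 1 := by
  have hd' : (2 : ℝ) ≤ d := by exact_mod_cast hd
  unfold doorPoly at h ⊢
  have h1 : c' ^ 2 ≤ c ^ 2 := by nlinarith
  nlinarith [mul_le_mul_of_nonneg_left h1 (by linarith : (0 : ℝ) ≤ 4 * d - 4),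
    mul_le_mul_of_nonneg_left hle (by linarith : (0 : ℝ) ≤ 4 * d - 6)]

/-! ### The resolvent equations `w = e_b + c·Adj·w`, reduced by symmetry

Links other than `a`: `ā` (adjacent to all `2d − 2` others), `b` and `b̄` (each adjacent to `ā` and the
`2d − 4` generic links), and `2d − 4` generic links `g` (each adjacent to `ā`, `b`, `b̄` and the `2d − 6`
generic links of other directions). -/

/-- Row `ā` of the resolvent equation: `D_ā = c·(D_b + D_b̄ + (2d−4) D_g)`. [folklore] -/
theorem col_eq_abar {d : ℕ} {c : ℝ} (h0 : 0 ≤ c) (hΔ : 0 < Delta d c) :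
    Dabar d c = c * (Db d c + Dbbar d c + (2 * (d : ℝ) - 4) * Dgen d c) := by
  have h2 : (1 : ℝ) + 2 * c ≠ 0 := by positivity
  have hΔ' : Delta d c ≠ 0 := hΔ.ne'
  unfold Dabar Db Dbbar Dgen
  field_simp
  unfold Delta
  ring

/-- Row `b` of the resolvent equation: `D_b = 1 + c·(D_ā + (2d−4) D_g)`. [folklore] -/
theorem col_eq_b {d : ℕ} {c : ℝ} (h0 : 0 ≤ c) (hΔ : 0 < Delta d c) :
    Db d c = 1 + c * (Dabar d c + (2 * (d : ℝ) - 4) * Dgen d c) := by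
  have h2 : (1 : ℝ) + 2 * c ≠ 0 := by positivity
  have hΔ' : Delta d c ≠ 0 := hΔ.ne'
  unfold Dabar Db Dbbar Dgen
  field_simp
  unfold Delta
  ring

/-- Row `b̄` of the resolvent equation: `D_b̄ = c·(D_ā + (2d−4) D_g)`. [folklore] -/
theorem col_eq_bbar {d : ℕ} {c : ℝ} (h0 : 0 ≤ c) (hΔ : 0 < Delta d c) :
    Dbbar d c = c * (Dabar d c + (2 * (d : ℝ) - 4) * Dgen d c) := by
  have h2 : (1 : ℝ) + 2 * c ≠ 0 := by positivity
  have hΔ' : Delta d c ≠ 0 := hΔ.ne'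
  unfold Dabar Dbbar Dgen
  field_simp
  ring

/-- Row `g` (generic) of the resolvent equation: `D_g = c·(D_ā + D_b + D_b̄ + (2d−6) D_g)`. [folklore] -/
theorem col_eq_gen {d : ℕ} {c : ℝ} (h0 : 0 ≤ c) (hΔ : 0 < Delta d c) :
    Dgen d c = c * (Dabar d c + Db d c + Dbbar d c + (2 * (d : ℝ) - 6) * Dgen d c) := by
  have h2 : (1 : ℝ) + 2 * c ≠ 0 := by positivity
  have hΔ' : Delta d c ≠ 0 := hΔ.ne'
  unfold Dabar Db Dbbar Dgen
  field_simp
  unfold Delta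
  ring

/-- The resolvent column is nonnegative below the pole (`d ≥ 2`, `c ≥ 0`, `Δ_d(c) > 0`). [folklore] -/
theorem col_nonneg {d : ℕ} (hd : 2 ≤ d) {c : ℝ} (h0 : 0 ≤ c) (hΔ : 0 < Delta d c) :
    0 ≤ Db d c ∧ 0 ≤ Dbbar d c ∧ 0 ≤ Dabar d c ∧ 0 ≤ Dgen d c := by
  have hd' : (2 : ℝ) ≤ d := by exact_mod_cast hd
  have h2 : (0 : ℝ) < 1 + 2 * c := by linarith
  have hnum : 0 ≤ (2 * (d : ℝ) - 3) + (2 * (d : ℝ) - 2) * c := by nlinarith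
  have hbbar : 0 ≤ Dbbar d c := by
    unfold Dbbar
    exact div_nonneg (mul_nonneg (sq_nonneg c) hnum) (mul_pos h2 hΔ).le
  refine ⟨?_, hbbar, ?_, ?_⟩
  · unfold Db; linarith
  · unfold Dabar; positivity
  · unfold Dgen; positivity

/-! ### The position count and the closed form -/

/-- **The count**: `R_G^{(d)}(c) = c·((2d−2)(D_b + D_ā + D_b̄) + (2d−2)(2d−4) D_g)` — a given star link
is seen in position `b` by `2d−2` ordered pairs, in position `ā` by `2d−2`, in position `b̄` by `2d−2`,
in generic position by `(2d−2)(2d−4)` (and in position `a`, weight `0`, by `2d−2`). [folklore] -/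
theorem gaugeR_eq_count {d : ℕ} {c : ℝ} (h0 : 0 ≤ c) (hΔ : 0 < Delta d c) :
    gaugeR d c = c * ((2 * (d : ℝ) - 2) * (Db d c + Dabar d c + Dbbar d c) +
      (2 * (d : ℝ) - 2) * (2 * (d : ℝ) - 4) * Dgen d c) := by
  have h2 : (1 : ℝ) + 2 * c ≠ 0 := by positivity
  have hΔ' : Delta d c ≠ 0 := hΔ.ne'
  unfold gaugeR Db Dabar Dbbar Dgen
  field_simp
  unfold Delta
  ring

/-! ### The door -/

/-- `R_G^{(d)}(c) ≥ 0` below the pole (`d ≥ 1`, `c ≥ 0`). [folklore] -/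
theorem gaugeR_nonneg {d : ℕ} (hd : 1 ≤ d) {c : ℝ} (h0 : 0 ≤ c) (hΔ : 0 < Delta d c) :
    0 ≤ gaugeR d c := by
  have hd' : (1 : ℝ) ≤ d := by exact_mod_cast hd
  unfold gaugeR
  exact div_nonneg (mul_nonneg (mul_nonneg (by linarith) h0) (by linarith)) hΔ.le

/-- Below the pole, `R_G^{(d)}(c) < 1 ↔ (4d−4)c² + (4d−6)c < 1`. [folklore] -/
theorem gaugeR_lt_one_iff {d : ℕ} {c : ℝ} (hΔ : 0 < Delta d c) :
    gaugeR d c < 1 ↔ doorPoly d c < 1 := by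
  unfold gaugeR doorPoly
  rw [div_lt_one hΔ]
  unfold Delta
  constructor <;> intro h <;> nlinarith

/-- **The door in dimension `d`**: `d ≥ 2`, `c ≥ 0` and `(4d−4)c² + (4d−6)c < 1` give
`0 ≤ R_G^{(d)}(c) < 1`. [folklore] -/
theorem gaugeR_lt_one_of_door {d : ℕ} (hd : 2 ≤ d) {c : ℝ} (h0 : 0 ≤ c) (h : doorPoly d c < 1) :
    0 ≤ gaugeR d c ∧ gaugeR d c < 1 :=
  ⟨gaugeR_nonneg (by omega) h0 (Delta_pos_of_door hd h0 h),
    (gaugeR_lt_one_iff (Delta_pos_of_door hd h0 h)).2 h⟩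

/-- **The exact threshold**: for `d ≥ 2` and `c ≥ 0`, the door condition holds iff
`c < c⋆(d) = (√(4d²−8d+5) − (2d−3))/(4(d−1))` (so `β⋆_G(d) = 4c⋆(d) = (√(4d²−8d+5) − (2d−3))/(d−1)`
in Wilson units for `SU(2)`). [folklore] -/
theorem doorCond_iff_lt_sqrt {d : ℕ} (hd : 2 ≤ d) {c : ℝ} (h0 : 0 ≤ c) :
    doorPoly d c < 1 ↔
      c < (Real.sqrt (4 * (d : ℝ) ^ 2 - 8 * d + 5) - (2 * (d : ℝ) - 3)) / (4 * ((d : ℝ) - 1)) := by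
  have hd' : (2 : ℝ) ≤ d := by exact_mod_cast hd
  have hD : (0 : ℝ) ≤ 4 * (d : ℝ) ^ 2 - 8 * d + 5 := by nlinarith
  have hs0 : 0 ≤ Real.sqrt (4 * (d : ℝ) ^ 2 - 8 * d + 5) := Real.sqrt_nonneg _
  have hs2 : Real.sqrt (4 * (d : ℝ) ^ 2 - 8 * d + 5) ^ 2 = 4 * (d : ℝ) ^ 2 - 8 * d + 5 :=
    Real.sq_sqrt hD
  have h4 : (0 : ℝ) < 4 * ((d : ℝ) - 1) := by linarith
  rw [lt_div_iff₀ h4]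
  unfold doorPoly
  -- `(4d−4)c² + (4d−6)c < 1 ↔ ((4d−4)c + (2d−3))² < 4d² − 8d + 5`
  have key : (4 * (d : ℝ) - 4) * c ^ 2 + (4 * (d : ℝ) - 6) * c < 1 ↔
      (c * (4 * ((d : ℝ) - 1)) + (2 * (d : ℝ) - 3)) ^ 2 < 4 * (d : ℝ) ^ 2 - 8 * d + 5 := by
    constructor <;> intro h <;> nlinarith
  rw [key]
  have hu : 0 ≤ c * (4 * ((d : ℝ) - 1)) + (2 * (d : ℝ) - 3) := by nlinarith
  constructor
  · intro h
    by_contra hneg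
    have h5 : Real.sqrt (4 * (d : ℝ) ^ 2 - 8 * d + 5) ≤ c * (4 * ((d : ℝ) - 1)) + (2 * (d : ℝ) - 3) := by
      linarith [not_lt.mp hneg]
    nlinarith [mul_le_mul h5 h5 hs0 hu]
  · intro h
    have h5 : c * (4 * ((d : ℝ) - 1)) + (2 * (d : ℝ) - 3) < Real.sqrt (4 * (d : ℝ) ^ 2 - 8 * d + 5) := by
      linarith
    nlinarith [mul_lt_mul'' h5 h5 hu hu]

/-! ### Consistency with the `d = 4` file and exact rows -/

/-- `Δ_4 = Δ` of `StarGaugeReceivedSum`. [folklore] -/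
theorem Delta_four (c : ℝ) : Delta 4 c = StarWindowGauge.Delta c := by
  unfold Delta StarWindowGauge.Delta; push_cast; ring

/-- **Consistency with the kernel row of record**: `R_G^{(4)}(c) = R_G(4c)` of `StarGaugeReceivedSum`
(`c = β_W/4`). [folklore] -/
theorem gaugeR_four (c : ℝ) : gaugeR 4 c = StarWindowGauge.gaugeR (4 * c) := by
  unfold gaugeR StarWindowGauge.gaugeR
  rw [show 4 * c / 4 = c by ring, ← Delta_four]
  push_cast; ring

/-- The four column values at `d = 4` are those of `StarGaugeReceivedSum`. [folklore] -/
theorem col_four (c : ℝ) : Db 4 c = StarWindowGauge.Dbb c ∧ Dbbar 4 c = StarWindowGauge.Dbbar c ∧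
    Dabar 4 c = StarWindowGauge.Dabar c ∧ Dgen 4 c = StarWindowGauge.Dgen c := by
  refine ⟨?_, ?_, ?_, ?_⟩
  · unfold Db Dbbar StarWindowGauge.Dbb; rw [← Delta_four]; push_cast; ring
  · unfold Dbbar StarWindowGauge.Dbbar; rw [← Delta_four]; push_cast; ring
  · unfold Dabar StarWindowGauge.Dabar; rw [← Delta_four]
  · unfold Dgen StarWindowGauge.Dgen; rw [← Delta_four]

/-- `d = 3` (`6` star links, single-site door `β_W < 1/3`): `R_G^{(3)}(5/36) = 205/209 < 1`
(`β_W = 5/9 = 0.5556`). [folklore] -/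
theorem gaugeR_three_5_36 : gaugeR 3 (5 / 36) = 205 / 209 := by
  unfold gaugeR Delta; norm_num

/-- `d = 3`: `R_G^{(3)}(1/8) = 9/11` (`β_W = 1/2`). [folklore] -/
theorem gaugeR_three_eighth : gaugeR 3 (1 / 8) = 9 / 11 := by
  unfold gaugeR Delta; norm_num

/-- `d = 4`: `R_G^{(4)}(9/100) = 2943/2957` (`β_W = 9/25`, the kernel row of record). [folklore] -/
theorem gaugeR_four_9_100 : gaugeR 4 (9 / 100) = 2943 / 2957 := by
  unfold gaugeR Delta; norm_num

/-- `d = 5` (`10` star links, single-site door `β_W < 1/6`): `R_G^{(5)}(13/200) = 2769/2881 < 1`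
(`β_W = 13/50 = 0.26`). [folklore] -/
theorem gaugeR_five_13_200 : gaugeR 5 (13 / 200) = 2769 / 2881 := by
  unfold gaugeR Delta; norm_num

/-- `d = 5`: `R_G^{(5)}(1/16) = 17/19` (`β_W = 1/4`). [folklore] -/
theorem gaugeR_five_sixteenth : gaugeR 5 (1 / 16) = 17 / 19 := by
  unfold gaugeR Delta; norm_num

/-- `d = 6` (`12` star links, single-site door `β_W < 2/15`): `R_G^{(6)}(1/20) = 21/23 < 1`
(`β_W = 1/5`). [folklore] -/
theorem gaugeR_six_twentieth : gaugeR 6 (1 / 20) = 21 / 23 := by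
  unfold gaugeR Delta; norm_num

/-- `d = 2` (sanity row; `d = 2` is exactly solvable): `R_G^{(2)}(1/4) = 5/7` (`β_W = 1`). [folklore] -/
theorem gaugeR_two_quarter : gaugeR 2 (1 / 4) = 5 / 7 := by
  unfold gaugeR Delta; norm_num

/-- Door rows: the door condition `P_d(c) < 1` at `(d, c) = (3, 5/36), (5, 13/200), (6, 1/20), (2, 3/10)`.
[folklore] -/
theorem doorPoly_rows : doorPoly 3 (5 / 36) < 1 ∧ doorPoly 5 (13 / 200) < 1 ∧ doorPoly 6 (1 / 20) < 1 ∧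
    doorPoly 2 (3 / 10) < 1 := by
  unfold doorPoly; norm_num

end Summit.Ventures.YMGap.StarResolventDim

end
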